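import Mathlib
import HarnessLib
import Literature.Analysis.FluidPDE.AxisymmetricEuler
import Literature.Analysis.FluidPDE.AxisymmetricVorticityTransport
import Literature.Analysis.FluidPDE.SwirlTransportProofs
import Literature.Analysis.FluidPDE.IsometryInvariance
import Literature.Analysis.FluidPDE.CurlFreeLiouville
import Literature.Analysis.FluidPDE.TaoEnstrophyLocalisation
import Literature.Analysis.FluidPDE.EnergyToolkit
import Literature.Analysis.FluidPDE.Vorticity
import Literature.Analysis.FluidPDE.VorticityCalculus
import Literature.Analysis.FluidPDE.TypeIAncientMildClassical
import Literature.Analysis.FluidPDE.SelfSimilar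
import Literature.Analysis.FluidPDE.LocalTypeI
import Literature.Analysis.FluidPDE.VectorCalculus
import Literature.Analysis.UnboundedOperators.HeatKernel
import Summits.NavierStokesRegularity.NavierStokesRegularity.Theorems.LocalSineTubeDoorProfileAlignedWindowRigidityAncient
import Summits.NavierStokesRegularity.NavierStokesRegularity.Theorems.PoloidalWindowDoorPoloidalWindowRigidityWindow
import Summits.NavierStokesRegularity.NavierStokesRegularity.Theorems.PoloidalWindowDoorPoloidalWindowRigidityFlat
import Summits.NavierStokesRegularity.NavierStokesRegularity.Theorems.PoloidalWindowDoorPoloidalWindowRigidityAxisymmetric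
import Summits.NavierStokesRegularity.NavierStokesRegularity.Theorems.PoloidalWindowDoorPoloidalWindowRigidityOneSlice
import Summits.NavierStokesRegularity.NavierStokesRegularity.Theorems.PoloidalWindowDoorPoloidalWindowRigidityVorticityTranslate

/-!
# Route `PoloidalWindowDoor`, crux `PoloidalWindowRigidity` (K2, stmt-NavierStokesRegularity-19708) — a further
# SETTLED STRATUM: the VORTICITY is axisymmetric about a vertical axis (the velocity is not assumed to be)

Cell ns-regularity-ideate, seat ns-poloidal-K2-p3 (stub-worker; support theorem `--supports` the crux, `--as helper`).
nsreg-p6's `…Axisymmetric` / `…OneSlice` settle the stratum of profiles whose VELOCITY is axisymmetric about a vertical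
axis (no swirl by poloidality, then KNSS 2009 Thm 5.2).  Here only the VORTICITY is assumed axisymmetric,
`curl v(s)(R_θ y) = R_θ curl v(s)(y)` for all rotations `R_θ` about the vertical axis and all slices `s < 0` — a
priori this allows e.g. a superposed uniform horizontal drift.  Still `v ≡ 0`:

* `sub_apply_zero_isAxisymmetric_of_curl` — for every `θ` the field `W_θ = R_{−θ} ∘ v(s) ∘ R_θ − v(s)` is `C²`,
  bounded, divergence-free and CURL-FREE (pseudovector law of the curl for rotations about the axis, tree
  `curlCLM_rotZL_conj`, and axisymmetry of the vorticity), hence constant (tree div–curl Liouville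
  `eq_of_curl_eq_zero_of_isDivFree_of_bounded`): `v(s) − v(s)(0)` IS axisymmetric;
* `fderiv_curl_apply_horizontal_eq_zero` — the vorticity equation at `s` (tree `IsVorticitySolutionOn.vorticity_eq`
  on a window, classical pressure by `IsTypeIAncientMild.exists_isClassicalNSSolutionOn_Ioo`) reads
  `Dω[b] = (ω·∇)ũ + Δω − ∂ₜω − (ũ·∇)ω` with `ũ = v(s) − b`, `b = v(s)(0)`; the right side is an axisymmetric field,
  while `Dω(R_π y)[b] = R_π Dω(y)[R_{−π} b]` (chain rule on `ω ∘ R = R ∘ ω`); comparing at `R_π` kills the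
  horizontal part: `Dω(y)[b_h] = 0` for all `y`, `b_h = (b₀, b₁, 0)`;
* `eq_zero_of_curl_axisymmetric` — if `b_h ≠ 0` the vorticity slice is invariant under the translations along `b_h`
  and this seat's stratum (A) `…VorticityTranslate.eq_zero_of_curl_translate_eq_slice` ends; if `b_h = 0` the
  velocity slice itself is axisymmetric and nsreg-p6's `…OneSlice.eq_zero_of_axisymmetric_slice` (KNSS 5.2) ends.
  `eq_zero_of_curl_axisymmetric_translate`: the same about the vertical axis through any centre `c` (nsreg-p6 `class_translate`).

WHAT THIS IS NOT: not a claim about Navier–Stokes regularity and not the open residue of the crux — one more settled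
stratum (vorticity-level axisymmetry) of a door route's Type-I Liouville problem (bears_on LADDER-NS N0, rung
N0-LocalTubeDoorPoloidal).
-/

noncomputable section

-- the summit and its single sub-problem share the name (CONVENTIONS §1), as in every Theorems file
set_option linter.dupNamespace false

namespace Summit.NavierStokesRegularity.NavierStokesRegularity.Theorems.PoloidalWindowDoorPoloidalWindowRigidityVorticityAxisymmetric

open MeasureTheory Set Function Filter Topology TopologicalSpace Metric InnerProductSpace
open scoped RealInnerProductSpace InnerProductSpace Laplacian ContDiff
open Literature.Analysis Literature.Analysis.FluidPDE
open Summit.NavierStokesRegularity.NavierStokesRegularity.Theorems.LocalSineTubeDoorProfileAlignedWindowRigidityAncient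
open Summit.NavierStokesRegularity.NavierStokesRegularity.Theorems.PoloidalWindowDoorPoloidalWindowRigidityWindow
open Summit.NavierStokesRegularity.NavierStokesRegularity.Theorems.PoloidalWindowDoorPoloidalWindowRigidityFlat
open Summit.NavierStokesRegularity.NavierStokesRegularity.Theorems.PoloidalWindowDoorPoloidalWindowRigidityAxisymmetric
open Summit.NavierStokesRegularity.NavierStokesRegularity.Theorems.PoloidalWindowDoorPoloidalWindowRigidityOneSlice
open Summit.NavierStokesRegularity.NavierStokesRegularity.Theorems.PoloidalWindowDoorPoloidalWindowRigidityVorticityTranslate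

/-! ### Kinematics: axisymmetric vorticity ⇒ the velocity minus its value on the axis is axisymmetric -/

/-- **A bounded incompressible `C²` field whose CURL is axisymmetric is axisymmetric up to a constant**:
`V(R_θ y) − V(0) = R_θ (V(y) − V(0))`.  For each `θ`, `W = R_{−θ} ∘ V ∘ R_θ − V` is `C²`, bounded, divergence-free
and curl-free (`curl (R_{−θ} V R_θ)(y) = R_{−θ} curl V (R_θ y) = curl V(y)` by the pseudovector law
`curlCLM_rotZL_conj` and the axisymmetry of `curl V`), hence constant by the tree's div–curl Liouville theorem. -/
theorem sub_apply_zero_isAxisymmetric_of_curl {V : EuclideanSpace ℝ (Fin 3) → EuclideanSpace ℝ (Fin 3)}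
    (hV : ContDiff ℝ 2 V) (hdiv : VectorCalculus.IsDivFree V) {M : ℝ} (hM : ∀ x, ‖V x‖ ≤ M)
    (haxi : IsAxisymmetric (curl V)) : IsAxisymmetric (fun y => V y - V 0) := by
  intro θ y
  -- the difference field for the angle `θ`
  set W : EuclideanSpace ℝ (Fin 3) → EuclideanSpace ℝ (Fin 3) := fun z => rotZL (-θ) (V (rotZL θ z)) - V z with hW
  have hVR : ContDiff ℝ 2 (fun z => rotZL (-θ) (V (rotZL θ z))) :=
    (rotZL (-θ)).contDiff.comp (hV.comp (rotZL θ).contDiff)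
  have hW2 : ContDiff ℝ 2 W := hVR.sub hV
  have hVd : ∀ z, DifferentiableAt ℝ V z := fun z => (hV.differentiable two_ne_zero) z
  -- the derivative of the conjugated field
  have hDconj : ∀ z, fderiv ℝ (fun z => rotZL (-θ) (V (rotZL θ z))) z =
      (rotZL (-θ)).comp ((fderiv ℝ V (rotZL θ z)).comp (rotZL θ)) := fun z => by
    have h1 : HasFDerivAt (fun z => V (rotZL θ z)) ((fderiv ℝ V (rotZL θ z)).comp (rotZL θ)) z :=
      (hVd (rotZL θ z)).hasFDerivAt.comp z (rotZL θ).hasFDerivAt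
    exact ((rotZL (-θ)).hasFDerivAt.comp z h1).fderiv
  have hDW : ∀ z, fderiv ℝ W z =
      (rotZL (-θ)).comp ((fderiv ℝ V (rotZL θ z)).comp (rotZL θ)) - fderiv ℝ V z := fun z => by
    rw [hW, fderiv_fun_sub ((hVR.differentiable two_ne_zero) z) (hVd z), hDconj z]
  -- `W` is curl-free
  have hcurlW : ∀ z, curl W z = 0 := fun z => by
    rw [curl_eq_curlCLM, hDW z, map_sub]
    have h1 : curlCLM ((rotZL (-θ)).comp ((fderiv ℝ V (rotZL θ z)).comp (rotZL θ))) =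
        rotZ (-θ) (curlCLM (fderiv ℝ V (rotZL θ z))) := by
      have h := curlCLM_rotZL_conj (-θ) (fderiv ℝ V (rotZL θ z))
      rw [neg_neg] at h
      exact h
    rw [h1, ← curl_eq_curlCLM, ← curl_eq_curlCLM, rotZL_apply, haxi θ z, ← rotZ_add, neg_add_cancel, rotZ_zero,
      sub_self]
  -- `W` is divergence-free
  have hdivW : VectorCalculus.IsDivFree W := by
    have hconj : VectorCalculus.IsDivFree (fun z => rotZLIE (-θ) (V ((rotZLIE (-θ)).symm z))) :=
      hdiv.conj_linearIsometryEquiv (rotZLIE (-θ))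
    have hconj' : VectorCalculus.IsDivFree (fun z => rotZL (-θ) (V (rotZL θ z))) := by
      have e : (fun z => rotZLIE (-θ) (V ((rotZLIE (-θ)).symm z))) = fun z => rotZL (-θ) (V (rotZL θ z)) := by
        funext z
        rw [rotZLIE_apply, rotZLIE_symm_apply, neg_neg, rotZL_apply, rotZL_apply]
      rw [← e]; exact hconj
    intro z
    have h1 := hconj' z
    have h2 := hdiv z
    unfold VectorCalculus.divergence at h1 h2 ⊢
    rw [hDW z, ContinuousLinearMap.toLinearMap_sub, map_sub, ← hDconj z, h1, h2, sub_self]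
  -- `W` is bounded
  have hWbd : ∀ z, ‖W z‖ ≤ 2 * M := fun z => by
    have h1 : ‖rotZL (-θ) (V (rotZL θ z))‖ ≤ M := by rw [rotZL_apply, norm_rotZ]; exact hM _
    exact (norm_sub_le _ _).trans (by linarith [hM z])
  -- hence constant: `W y = W 0`
  have hconst := eq_of_curl_eq_zero_of_isDivFree_of_bounded hW2 hcurlW hdivW hWbd y 0
  have h0 : rotZL θ (0 : EuclideanSpace ℝ (Fin 3)) = 0 := map_zero _
  simp only [hW, h0] at hconst
  -- unwind: apply `R_θ`
  have h1 := congrArg (rotZL θ) hconst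
  rw [map_sub, map_sub, ← ContinuousLinearMap.comp_apply, rotZL_comp_neg, ContinuousLinearMap.id_apply,
    ← ContinuousLinearMap.comp_apply, rotZL_comp_neg, ContinuousLinearMap.id_apply] at h1
  -- `V (R y) - R (V y) = V 0 - R (V 0)`
  simp only [rotZL_apply] at h1
  have h2 := (rotZL θ).map_sub (V y) (V 0)
  simp only [rotZL_apply] at h2
  rw [h2]
  exact sub_eq_sub_iff_sub_eq_sub.mp h1

variable {C : ℝ} {v : ℝ → EuclideanSpace ℝ (Fin 3) → EuclideanSpace ℝ (Fin 3)}

/-! ### Dynamics: the horizontal drift is invisible to the vorticity -/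

/-- **The vorticity of a profile with axisymmetric vorticity has zero derivative along the horizontal part of the
axis value of the velocity.**  For a profile of the route's Type-I class whose vorticity is axisymmetric about the
vertical axis on every slice, `s < 0`, `b = v(s)(0)`, `b_h = (b₀, b₁, 0)`: `D(curl v(s))(y)[b_h] = 0` for all `y`
(vorticity equation: `Dω[b]` equals the axisymmetric field `(ω·∇)ũ + Δω − ∂ₜω − (ũ·∇)ω`, `ũ = v(s) − b` axisymmetric
by `sub_apply_zero_isAxisymmetric_of_curl`; and `Dω(R_π y)[b] = R_π Dω(y)[R_{−π} b]`). -/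
theorem fderiv_curl_apply_horizontal_eq_zero (hrate : HasTypeITimeDecay C v)
    (hcont : ContinuousOn (uncurry v) (Iio (0 : ℝ) ×ˢ univ))
    (hmild : ∀ s t : ℝ, s < t → t < 0 → ∀ x,
      v t x = UnboundedOperators.heatExtension (v s) (t - s) x - oseenDuhamel 1 s v v t x)
    (hdiv : ∀ t < 0, VectorCalculus.IsDivFree (v t))
    (haxi : ∀ s < 0, IsAxisymmetric (curl (v s))) {s : ℝ} (hs : s < 0) (y : EuclideanSpace ℝ (Fin 3)) :
    fderiv ℝ (curl (v s)) y (WithLp.toLp 2 ![v s 0 0, v s 0 1, 0]) = 0 := by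
  have hbdd := bdd_of_hasTypeITimeDecay hrate
  -- ## the vorticity equation on the window `(2s, 0)`
  have h2s : 2 * s < 0 := by linarith
  have hS : UniqueDiffOn ℝ (Ioo (2 * s) 0) := isOpen_Ioo.uniqueDiffOn
  have hsS : s ∈ Ioo (2 * s) 0 := ⟨by linarith, hs⟩
  have hV : IsVorticitySolutionOn (Ioo (2 * s) 0) 1 v := by
    obtain ⟨p, hns⟩ :=
      (isTypeIAncientMild_of_class hrate hcont hmild hdiv).exists_isClassicalNSSolutionOn_Ioo h2s
    exact hns.isVorticitySolutionOn_zero_force isOpen_Ioo.uniqueDiffOn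
      (by rw [isOpen_Ioo.interior_eq]; exact subset_closure)
  have hω : IsSmoothSpaceTimeOn (Ioo (2 * s) 0) (vorticity v) :=
    hV.smooth_velocity.isSmoothSpaceTimeOn_vorticity hS
  have hv3 : ContDiff ℝ 3 (v s) := contDiff_infty.1 (hV.contDiff_velocity hsS) 3
  have hv2 : ContDiff ℝ 2 (v s) := hv3.of_le (by norm_num)
  have hc2 : ContDiff ℝ 2 (curl (v s)) := contDiff_curl (n := 2) (by exact_mod_cast hv3)
  have hvd : Differentiable ℝ (v s) := hv2.differentiable two_ne_zero
  have hcd : Differentiable ℝ (curl (v s)) := hc2.differentiable two_ne_zero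
  -- ## `ũ = v(s) − b` is axisymmetric, `b = v(s)(0)`
  set b : EuclideanSpace ℝ (Fin 3) := v s 0 with hb
  have hũ : IsAxisymmetric (fun z => v s z - b) :=
    sub_apply_zero_isAxisymmetric_of_curl hv2 (hdiv s hs) (fun x => hrate s hs x) (haxi s hs)
  have hũd : Differentiable ℝ (fun z => v s z - b) := hvd.sub_const b
  have hDũ : ∀ z, fderiv ℝ (fun z => v s z - b) z = fderiv ℝ (v s) z := fun z => fderiv_sub_const b
  -- abbreviations
  set omg : EuclideanSpace ℝ (Fin 3) → EuclideanSpace ℝ (Fin 3) := curl (v s) with hωdef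
  have hωax : IsAxisymmetric omg := haxi s hs
  have hvort : vorticity v s = omg := rfl
  -- ## `G(y) := Dω(y)[b]` is an axisymmetric field
  set G : EuclideanSpace ℝ (Fin 3) → EuclideanSpace ℝ (Fin 3) := fun z => fderiv ℝ omg z b with hG
  have hGeq : ∀ z, G z = convect omg (fun z => v s z - b) z + (Δ omg) z
      - timeDerivWithin (Ioo (2 * s) 0) (vorticity v) s z - fderiv ℝ omg z (v s z - b) := fun z => by
    have heq := hV.vorticity_eq s hsS z
    rw [hvort, one_smul] at heq
    have e1 : convect (v s) omg z = fderiv ℝ omg z (v s z - b) + G z := by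
      rw [convect, hG]; simp only
      rw [← map_add, sub_add_cancel]
    have e2 : convect omg (v s) z = convect omg (fun z => v s z - b) z := by
      rw [convect, convect, hDũ z]
    rw [e1, e2] at heq
    linear_combination (norm := skip) heq
    abel
  have hGax : IsAxisymmetric G := by
    intro θ z
    -- each term is equivariant
    have hT : timeDerivWithin (Ioo (2 * s) 0) (vorticity v) s (rotZ θ z) =
        rotZ θ (timeDerivWithin (Ioo (2 * s) 0) (vorticity v) s z) := by
      have h1 : timeDerivWithin (Ioo (2 * s) 0) (vorticity v) s (rotZ θ z) =
          timeDerivWithin (Ioo (2 * s) 0) (fun τ x => rotZL θ (vorticity v τ x)) s z := by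
        simp only [timeDerivWithin_apply]
        refine derivWithin_congr (fun τ hτ => ?_) ?_
        · exact haxi τ hτ.2 θ z
        · exact haxi s hs θ z
      rw [h1, hω.timeDerivWithin_clm_comp hS (rotZL θ) hsS z, rotZL_apply]
    have hX1 : convect omg (fun z => v s z - b) (rotZ θ z) = rotZ θ (convect omg (fun z => v s z - b) z) := by
      rw [convect, convect, hũ.fderiv_rotZ hũd θ z]
      simp only [ContinuousLinearMap.comp_apply, rotZL_apply]
      rw [hωax θ z, ← rotZ_add, neg_add_cancel, rotZ_zero]
    have hX2 : fderiv ℝ omg (rotZ θ z) (v s (rotZ θ z) - b) = rotZ θ (fderiv ℝ omg z (v s z - b)) := by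
      rw [hωax.fderiv_rotZ hcd θ z]
      simp only [ContinuousLinearMap.comp_apply, rotZL_apply]
      have h := hũ θ z
      simp only at h
      rw [h, ← rotZ_add, neg_add_cancel, rotZ_zero]
    have hL : (Δ omg) (rotZ θ z) = rotZ θ ((Δ omg) z) := by
      have e : omg = fun x => rotZLIE θ (omg ((rotZLIE θ).symm x)) := by
        funext x
        rw [rotZLIE_apply, rotZLIE_symm_apply, ← hωax θ, ← rotZ_add, add_neg_cancel, rotZ_zero]
      have h := laplacian_conj_linearIsometryEquiv (rotZLIE θ) omg (rotZ θ z)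
      rw [← e, rotZLIE_symm_apply, ← rotZ_add, neg_add_cancel, rotZ_zero, rotZLIE_apply] at h
      exact h
    rw [hGeq, hGeq, hX1, hL, hT, hX2]
    have hlin := rotZL θ
    simp only [← rotZL_apply, map_add, map_sub]
  -- ## anti-symmetry under `R_π`: `G(R_π y) = R_π Dω(y)[R_{−π} b]`
  have hanti : G (rotZ Real.pi y) = rotZ Real.pi (fderiv ℝ omg y (rotZ (-Real.pi) b)) := by
    simp only [hG]
    rw [hωax.fderiv_rotZ hcd Real.pi y]
    simp only [ContinuousLinearMap.comp_apply, rotZL_apply]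
  have hkey : fderiv ℝ omg y (rotZ (-Real.pi) b) = fderiv ℝ omg y b := by
    have h1 : rotZ Real.pi (fderiv ℝ omg y (rotZ (-Real.pi) b)) = rotZ Real.pi (fderiv ℝ omg y b) := by
      rw [← hanti, hGax Real.pi y]
    have h2 := congrArg (rotZ (-Real.pi)) h1
    rwa [← rotZ_add, ← rotZ_add, neg_add_cancel, rotZ_zero, rotZ_zero] at h2
  -- `b − R_{−π} b = 2 b_h`
  have hbh : b - rotZ (-Real.pi) b = (2 : ℝ) • (WithLp.toLp 2 ![b 0, b 1, 0] : EuclideanSpace ℝ (Fin 3)) := by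
    ext i
    fin_cases i <;> simp [rotZ, Real.cos_neg, Real.sin_neg, Real.cos_pi, Real.sin_pi] <;> ring
  have h3 : fderiv ℝ omg y (b - rotZ (-Real.pi) b) = 0 := by rw [map_sub, hkey, sub_self]
  rw [hbh, map_smul] at h3
  simpa using h3

/-! ### The stratum -/

/-- **Axisymmetric VORTICITY (vertical axis through the origin) ⇒ trivial.**  A profile of the route's Type-I class,
poloidal along `e₃`, whose vorticity is axisymmetric about the vertical axis through `0` on every slice, vanishes
identically: with `b = v(s)(0)`, either `b_h ≠ 0` and the vorticity slice is invariant under the translations along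
`b_h` (`fderiv_curl_apply_horizontal_eq_zero`) — stratum (A) `eq_zero_of_curl_translate_eq_slice` — or `b_h = 0` and
the velocity slice is axisymmetric (`sub_apply_zero_isAxisymmetric_of_curl`, `R_θ (b₂e₃) = b₂e₃`) — nsreg-p6's
`eq_zero_of_axisymmetric_slice` (no swirl by poloidality, KNSS 2009 Thm 5.2). -/
theorem eq_zero_of_curl_axisymmetric (hrate : HasTypeITimeDecay C v)
    (hcont : ContinuousOn (uncurry v) (Iio (0 : ℝ) ×ˢ univ))
    (hmild : ∀ s t : ℝ, s < t → t < 0 → ∀ x,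
      v t x = UnboundedOperators.heatExtension (v s) (t - s) x - oseenDuhamel 1 s v v t x)
    (hdiv : ∀ t < 0, VectorCalculus.IsDivFree (v t))
    (hpol : ∀ s < 0, ∀ y, ⟪curl (v s) y, EuclideanSpace.single 2 1⟫_ℝ = 0)
    (haxi : ∀ s < 0, IsAxisymmetric (curl (v s))) : ∀ t < 0, ∀ x, v t x = 0 := by
  have hs : (-1 : ℝ) < 0 := by norm_num
  have hbdd := bdd_of_hasTypeITimeDecay hrate
  set b : EuclideanSpace ℝ (Fin 3) := v (-1) 0 with hb
  set bh : EuclideanSpace ℝ (Fin 3) := WithLp.toLp 2 ![b 0, b 1, 0] with hbh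
  have hC2 : ContDiff ℝ 2 (v (-1)) := (analyticOnNhd_slice hcont hbdd hmild hs).contDiff
  have hC3 : ContDiff ℝ 3 (v (-1)) := (analyticOnNhd_slice hcont hbdd hmild hs).contDiff
  by_cases hzero : bh = 0
  · -- ## `b_h = 0`: the velocity slice is axisymmetric
    have hũ : IsAxisymmetric (fun z => v (-1) z - b) :=
      sub_apply_zero_isAxisymmetric_of_curl hC2 (hdiv (-1) hs) (fun x => hrate (-1) hs x) (haxi (-1) hs)
    have hb0 : b 0 = 0 := by simpa [hbh] using congrArg (fun w : EuclideanSpace ℝ (Fin 3) => w 0) hzero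
    have hb1 : b 1 = 0 := by simpa [hbh] using congrArg (fun w : EuclideanSpace ℝ (Fin 3) => w 1) hzero
    have hRb : ∀ θ, rotZ θ b = b := fun θ => by
      ext i; fin_cases i <;> simp [rotZ, hb0, hb1]
    have hax : IsAxisymmetric (fun z => v (-1) (z + 0)) := by
      intro θ z
      simp only [add_zero]
      have h := hũ θ z
      simp only at h
      have h2 : rotZ θ (v (-1) z - b) = rotZ θ (v (-1) z) - b := by
        rw [← rotZL_apply, map_sub, rotZL_apply, rotZL_apply, hRb]
      rw [h2] at h
      exact sub_left_injective h
    exact eq_zero_of_axisymmetric_slice hrate hcont hmild hdiv hpol 0 hs hax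
  · -- ## `b_h ≠ 0`: the vorticity slice is invariant under the translations along `b_h`
    have hD : ∀ y, fderiv ℝ (curl (v (-1))) y bh = 0 := fun y =>
      fderiv_curl_apply_horizontal_eq_zero hrate hcont hmild hdiv haxi hs y
    have hcd : Differentiable ℝ (curl (v (-1))) :=
      (contDiff_curl (n := 2) (by exact_mod_cast hC3)).differentiable two_ne_zero
    have hinv : ∀ (y : EuclideanSpace ℝ (Fin 3)) (l : ℝ), curl (v (-1)) (y + l • bh) = curl (v (-1)) y := by
      intro y l
      -- the line `l ↦ ω(y + l b_h)` has zero derivative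
      have hline : ∀ σ : ℝ, HasDerivAt (fun σ : ℝ => curl (v (-1)) (y + σ • bh)) (0 : EuclideanSpace ℝ (Fin 3)) σ := by
        intro σ
        have hl : HasDerivAt (fun σ : ℝ => y + σ • bh) bh σ := by
          simpa using ((hasDerivAt_id σ).smul_const bh).const_add y
        have h := (hcd (y + σ • bh)).hasFDerivAt.comp_hasDerivAt σ hl
        rwa [hD] at h
      have hconst := is_const_of_deriv_eq_zero (fun σ => (hline σ).differentiableAt) (fun σ => (hline σ).deriv) l 0
      simpa using hconst
    exact eq_zero_of_curl_translate_eq_slice hrate hcont hmild hdiv hs hzero hinv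

/-- **Axisymmetric vorticity ⇒ not backward-singular.** -/
theorem nonflatLiouville_of_curl_axisymmetric (hrate : HasTypeITimeDecay C v)
    (hcont : ContinuousOn (uncurry v) (Iio (0 : ℝ) ×ˢ univ))
    (hmild : ∀ s t : ℝ, s < t → t < 0 → ∀ x,
      v t x = UnboundedOperators.heatExtension (v s) (t - s) x - oseenDuhamel 1 s v v t x)
    (hdiv : ∀ t < 0, VectorCalculus.IsDivFree (v t))
    (hpol : ∀ s < 0, ∀ y, ⟪curl (v s) y, EuclideanSpace.single 2 1⟫_ℝ = 0)
    (haxi : ∀ s < 0, IsAxisymmetric (curl (v s))) : ¬ IsBackwardSingularPoint v 0 :=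
  not_backwardSingular_of_zero (eq_zero_of_curl_axisymmetric hrate hcont hmild hdiv hpol haxi)


/-- **Axisymmetric VORTICITY about ANY vertical axis `c + ℝe₃` ⇒ trivial** (`eq_zero_of_curl_axisymmetric` for the
translated profile `v(t, · + c)`, which is again in the class — nsreg-p6 `class_translate` — and poloidal). -/
theorem eq_zero_of_curl_axisymmetric_translate (c : EuclideanSpace ℝ (Fin 3)) (hrate : HasTypeITimeDecay C v)
    (hcont : ContinuousOn (uncurry v) (Iio (0 : ℝ) ×ˢ univ))
    (hmild : ∀ s t : ℝ, s < t → t < 0 → ∀ x,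
      v t x = UnboundedOperators.heatExtension (v s) (t - s) x - oseenDuhamel 1 s v v t x)
    (hdiv : ∀ t < 0, VectorCalculus.IsDivFree (v t))
    (hpol : ∀ s < 0, ∀ y, ⟪curl (v s) y, EuclideanSpace.single 2 1⟫_ℝ = 0)
    (haxi : ∀ s < 0, IsAxisymmetric (fun y => curl (v s) (y + c))) : ∀ t < 0, ∀ x, v t x = 0 := by
  obtain ⟨hrate₁, hcont₁, hmild₁, hdiv₁⟩ := class_translate c hrate hcont hmild hdiv
  have hcurl : ∀ s (y : EuclideanSpace ℝ (Fin 3)), curl (fun y => v s (y + c)) y = curl (v s) (y + c) :=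
    fun s y => by rw [curl_eq_curlCLM, curl_eq_curlCLM, fderiv_comp_add_right]
  have hpol₁ : ∀ s < 0, ∀ y, ⟪curl ((fun t y => v t (y + c)) s) y, EuclideanSpace.single 2 1⟫_ℝ = 0 :=
    fun s hs y => by
      show ⟪curl (fun y => v s (y + c)) y, EuclideanSpace.single 2 1⟫_ℝ = 0
      rw [hcurl]; exact hpol s hs (y + c)
  have haxi₁ : ∀ s < 0, IsAxisymmetric (curl ((fun t y => v t (y + c)) s)) := fun s hs => by
    have e : curl (fun y => v s (y + c)) = fun y => curl (v s) (y + c) := funext (hcurl s)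
    show IsAxisymmetric (curl (fun y => v s (y + c)))
    rw [e]; exact haxi s hs
  have h := eq_zero_of_curl_axisymmetric hrate₁ hcont₁ hmild₁ hdiv₁ hpol₁ haxi₁
  intro t ht x
  have h1 := h t ht (x - c)
  simpa using h1

/-- **Axisymmetric vorticity about any vertical axis ⇒ not backward-singular.** -/
theorem nonflatLiouville_of_curl_axisymmetric_translate (c : EuclideanSpace ℝ (Fin 3))
    (hrate : HasTypeITimeDecay C v)
    (hcont : ContinuousOn (uncurry v) (Iio (0 : ℝ) ×ˢ univ))
    (hmild : ∀ s t : ℝ, s < t → t < 0 → ∀ x,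
      v t x = UnboundedOperators.heatExtension (v s) (t - s) x - oseenDuhamel 1 s v v t x)
    (hdiv : ∀ t < 0, VectorCalculus.IsDivFree (v t))
    (hpol : ∀ s < 0, ∀ y, ⟪curl (v s) y, EuclideanSpace.single 2 1⟫_ℝ = 0)
    (haxi : ∀ s < 0, IsAxisymmetric (fun y => curl (v s) (y + c))) : ¬ IsBackwardSingularPoint v 0 :=
  not_backwardSingular_of_zero (eq_zero_of_curl_axisymmetric_translate c hrate hcont hmild hdiv hpol haxi)

end Summit.NavierStokesRegularity.NavierStokesRegularity.Theorems.PoloidalWindowDoorPoloidalWindowRigidityVorticityAxisymmetric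

end
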